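import Summits.ValiantsHypothesis.ValiantsHypothesis.Theorems.BarrierLeverNaturalProofsSeparateVNPBorder

/-!
# Route BarrierLever — item `NaturalProofsSeparateVNP` (stmt-ValiantsHypothesis-18972): WITHOUT
# CONSTRUCTIVITY the item's uniform statement IS a border separation (cell valiant-natproofs, seat
# val-np-p4 gen 5; bears on ladder rung V4 and links it to the border / GCT column)

`S := Theses.BarrierLever.NaturalProofsSeparateVNP` is `∃ b₁ ∀ b n₀ ∃ n ≥ n₀ ∃ D,
IsNaturalProof (degLEMonomials n) (SmallCircuits ℂ n b) (Distinguishers ℂ n 1) D ∧ ∃ g ∈ VNP_{n,b₁},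
D(coeff g) ≠ 0`. Its sibling `…NaturalProofsSeparateVNPNonconstructive` shows that with the two
leading quantifiers swapped (`∀ b ∃ b₁`) and the constructivity clause `D ∈ Distinguishers ℂ n 1`
dropped the statement is a theorem. This file identifies what the UNIFORM quantifier `∃ b₁ ∀ b`
says when constructivity is dropped (`𝒟 = Set.univ`, an equation in the sense of KRST 2022 Def. 4):

* `Nonconstructive.univ_separate_iff_exists_family` — for fixed `b₁`: "for every `b`, infinitely
  often, SOME nonzero equation of `coeff(SmallCircuits ℂ n b)` has a non-root in
  `SmallDefinable ℂ n b₁`" **iff** some family `h` with `h n ∈ SmallDefinable ℂ n b₁` for all `n`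
  has approximate complexity `\underline{L}(h_n)` (BLMW 2011 Def. 9.3.1, tree `approxComplexity`)
  NOT p-bounded (`¬ IsVPBarFamily h`). So the item minus constructivity is exactly the border
  separation "pointwise-`VNP`-succinct families ⊄ `\overline{VP}`", and the item proper
  (`naturalProofsSeparateVNP_iff_exists_family`: a level-ONE natural proof at such a family) adds
  constructivity `N^{O(1)}` on top of it.
* Ingredients: `exists_family_of_separate` — the diagonal family extraction of
  `naturalProofsSeparateVNP_iff_exists_family` for an ARBITRARY level-wise distinguisher class and
  definability exponent; `not_isVPBarFamily_of_family` — equations of any constructivity are border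
  lower bounds (class-agnostic form of `Border.not_isVPBarFamily_of_naturalProofAgainstVP`);
  `coeffVec_mem_zariskiClosure_of_coeffVector_mem` — transfer from the Zariski closure in the
  finite coefficient space `degLEMonomials n → ℂ` to the one in the full coefficient space;
  `exists_univ_of_lt_approxComplexity` — conversely, `deg g ≤ n` and `\underline{L}(g) > n^b` force an
  equation of `coeff(SmallCircuits ℂ n b)` with non-root `g`; `exists_ge_pow_lt_of_not_isPBounded`.
* Corollaries: `exists_isVNPFamily_not_isVPBarFamily_of_univ_separate` (the non-constructive
  uniform statement ⇒ `VNP ⊄ \overline{VP}`, with `KRSTResidualBand.isVNPFamily_of_mem_smallDefinable`),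
  `univ_separate_of_naturalProofsSeparateVNP` (the item ⇒ its non-constructive shadow; composing
  the two re-derives `Border.exists_isVNPFamily_not_isVPBarFamily`).

WHAT THIS IS NOT: not a proof or refutation of item 18972 (parked on crux 14610); an EQUIVALENCE
between two open statements and implications from the open item; nothing here is progress on
`VP ≠ VNP`, on `VNP ⊄ \overline{VP}`, on FSV Question 6 or on the hardness of the permanent. That
algebraically natural proofs are border lower bounds is folklore (FSV 2018 §1.1, GKSS 2017 §1).

References: [ForbesShpilkaVolk2018] Def. 1, §1.1, Question 2; [BurgisserEtAl2011] Def. 9.3.1,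
§9.3; [Burgisser2000] Def. 2.1, 2.5; [KumarRamyaSaptharishiTengse2022] Def. 3–4.
-/

-- layout Summits/ValiantsHypothesis/ValiantsHypothesis forces the duplicated namespace component
set_option linter.dupNamespace false

noncomputable section

namespace Summit.ValiantsHypothesis.ValiantsHypothesis.Theorems.BarrierLever.NaturalProofsSeparateVNP

open Literature.Barriers.ValiantsHypothesis Literature.Computability.AlgebraicComplexity MvPolynomial
open Summit.ValiantsHypothesis.ValiantsHypothesis.Theses
open Summit.ValiantsHypothesis.ValiantsHypothesis.Theorems.BarrierLever.SuccinctHittingSetsForVP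

namespace Nonconstructive

/-! ### Without constructivity, the UNIFORM statement is border complexity -/

/-- **Family extraction** (the diagonal choice of `naturalProofsSeparateVNP_iff_exists_family`, for
an arbitrary level-wise distinguisher class `𝒟` and definability exponent `b₁`): if for every `b`,
infinitely often, a `𝒟 n`-natural proof against `SmallCircuits ℂ n b` has a non-root in
`SmallDefinable ℂ n b₁`, then ONE family `h`, pointwise in `SmallDefinable ℂ n b₁`, carries such
natural proofs for every `b` — per `n`, take the non-root at the largest good exponent `≤ n`
(`Nat.findGreatest`), using monotonicity in `b` (`isNaturalProof_of_le_size`).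
[cite: ForbesShpilkaVolk2018, Def. 1 and Question 2] -/
theorem exists_family_of_separate {𝒟 : ∀ n : ℕ, Set (MvPolynomial (degLEMonomials n) ℂ)} {b₁ : ℕ}
    (hsep : ∀ b n₀ : ℕ, ∃ n : ℕ, n₀ ≤ n ∧ ∃ D : MvPolynomial (degLEMonomials n) ℂ,
      IsNaturalProof (degLEMonomials n) (SmallCircuits ℂ n b) (𝒟 n) D ∧
      ∃ g ∈ SmallDefinable ℂ n b₁, eval (coeffVector (degLEMonomials n) g) D ≠ 0) :
    ∃ h : ∀ n, MvPolynomial (Fin n) ℂ, (∀ n, h n ∈ SmallDefinable ℂ n b₁) ∧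
      ∀ b n₀ : ℕ, ∃ n : ℕ, n₀ ≤ n ∧ ∃ D : MvPolynomial (degLEMonomials n) ℂ,
        IsNaturalProof (degLEMonomials n) (SmallCircuits ℂ n b) (𝒟 n) D ∧
        eval (coeffVector (degLEMonomials n) (h n)) D ≠ 0 := by
  classical
  -- the "good exponent" predicate, opaquely
  obtain ⟨P, hP⟩ : ∃ P : ℕ → ℕ → Prop, ∀ n b, (P n b ↔
      ∃ D, IsNaturalProof (degLEMonomials n) (SmallCircuits ℂ n b) (𝒟 n) D ∧
        ∃ g ∈ SmallDefinable ℂ n b₁, eval (coeffVector (degLEMonomials n) g) D ≠ 0) :=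
    ⟨_, fun _ _ => Iff.rfl⟩
  have key : ∀ n : ℕ, ∃ g ∈ SmallDefinable ℂ n b₁, ∀ b : ℕ, b ≤ n → 1 ≤ n → P n b →
      ∃ D, IsNaturalProof (degLEMonomials n) (SmallCircuits ℂ n b) (𝒟 n) D ∧
        eval (coeffVector (degLEMonomials n) g) D ≠ 0 := by
    intro n
    by_cases hex : ∃ b, b ≤ n ∧ P n b
    · obtain ⟨b₀, hb₀, hP₀⟩ := hex
      obtain ⟨D, hD, g, hg, hne⟩ := (hP n _).1 (Nat.findGreatest_spec (P := P n) hb₀ hP₀)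
      exact ⟨g, hg, fun b hb hn hPb =>
        ⟨D, isNaturalProof_of_le_size hn (Nat.le_findGreatest hb hPb) hD, hne⟩⟩
    · exact ⟨0, KRSTResidualBand.zero_mem_smallDefinable n b₁,
        fun b hb _ hPb => absurd ⟨b, hb, hPb⟩ hex⟩
  choose g hg hbest using key
  refine ⟨g, hg, fun b n₀ => ?_⟩
  obtain ⟨n, hn, D, hD, g', hg', hne⟩ := hsep b (max n₀ (max b 1))
  have hbn : b ≤ n := ((le_max_left _ _).trans (le_max_right _ _)).trans hn
  have h1n : 1 ≤ n := ((le_max_right _ _).trans (le_max_right _ _)).trans hn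
  obtain ⟨D', hD', hne'⟩ := hbest n b hbn h1n ((hP n b).2 ⟨D, hD, g', hg', hne⟩)
  exact ⟨n, (le_max_left _ _).trans hn, D', hD', hne'⟩

/-- **Natural proofs of ANY constructivity are border lower bounds** (the class-agnostic form of
`Border.not_isVPBarFamily_of_naturalProofAgainstVP`): a family at which, for every `b`, infinitely
often some equation of `coeff(SmallCircuits ℂ n b)` does not vanish is not in `\overline{VP}`.
[cite: ForbesShpilkaVolk2018, §1.1] [cite: BurgisserEtAl2011, Def. 9.3.1] -/
theorem not_isVPBarFamily_of_family {𝒟 : ∀ n : ℕ, Set (MvPolynomial (degLEMonomials n) ℂ)}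
    {h : ∀ n, MvPolynomial (Fin n) ℂ}
    (hnat : ∀ b n₀ : ℕ, ∃ n : ℕ, n₀ ≤ n ∧ ∃ D : MvPolynomial (degLEMonomials n) ℂ,
      IsNaturalProof (degLEMonomials n) (SmallCircuits ℂ n b) (𝒟 n) D ∧
      eval (coeffVector (degLEMonomials n) (h n)) D ≠ 0) : ¬ IsVPBarFamily h := by
  intro hbar
  obtain ⟨A, B, hAB⟩ := (IsPBounded.iff_exists_le_mul_succ_pow _).1 hbar
  obtain ⟨n₀, hn₀⟩ := Border.truncation_budget A B
  obtain ⟨n, hn, D, ⟨-, -, hvan⟩, hne⟩ := hnat (B + 3) n₀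
  exact absurd (hAB n) (not_le.mpr (Border.lt_approxComplexity hvan hne (hn₀ n hn)))

/-- **Transfer between the two Zariski closures.** For `g` of degree `≤ n`: if `coeff_{≤ n} g` lies in
the closure of `coeff_{≤ n}({f : deg f ≤ n, L(f) ≤ R})` inside the FINITE coefficient space
`degLEMonomials n → ℂ`, then the full coefficient vector `coeff g` lies in the closure of
`coeff({f : L(f) ≤ R})` inside the full coefficient space (a test polynomial there restricts to the
degree-`≤ n` coordinates, the others vanishing on polynomials of degree `≤ n`). Mumford, Red book
I §2. [folklore] -/
theorem coeffVec_mem_zariskiClosure_of_coeffVector_mem {n R : ℕ} {g : MvPolynomial (Fin n) ℂ}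
    (hdeg : g.totalDegree ≤ n)
    (hmem : coeffVector (degLEMonomials n) g ∈ zariskiClosure (coeffVector (degLEMonomials n) ''
      {f : MvPolynomial (Fin n) ℂ | f.totalDegree ≤ n ∧ complexity f ≤ R})) :
    coeffVec g ∈ zariskiClosure (coeffVec '' {f : MvPolynomial (Fin n) ℂ | complexity f ≤ R}) := by
  classical
  rw [mem_zariskiClosure_iff] at hmem ⊢
  intro p hp
  -- restrict `p` to the degree-`≤ n` coordinates
  let φ : (Fin n →₀ ℕ) → MvPolynomial (degLEMonomials n) ℂ :=
    fun m => if hm : m.degree ≤ n then X ⟨m, hm⟩ else 0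
  have key : ∀ f : MvPolynomial (Fin n) ℂ, f.totalDegree ≤ n →
      aeval (coeffVector (degLEMonomials n) f) (bind₁ φ p) = aeval (coeffVec f) p := by
    intro f hf
    have hfun : (fun m => aeval (coeffVector (degLEMonomials n) f) (φ m)) = coeffVec f := by
      funext m
      by_cases hm : m.degree ≤ n
      · simp only [φ, dif_pos hm, aeval_X, coeffVector_apply]
        rfl
      · simp only [φ, dif_neg hm, map_zero]
        symm
        show coeff m f = 0
        refine coeff_eq_zero_of_totalDegree_lt ?_
        rw [← Finsupp.degree_apply]
        exact lt_of_le_of_lt hf (not_le.mp hm)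
    rw [aeval_bind₁, hfun]
  rw [← key g hdeg]
  refine hmem (bind₁ φ p) ?_
  rintro _ ⟨f, ⟨hfdeg, hfR⟩, rfl⟩
  rw [key f hfdeg]
  exact hp _ ⟨f, hfR, rfl⟩

/-- **Large approximate complexity forces an equation with that non-root.** If `deg g ≤ n` and
`\underline{L}(g) > n^b`, then some nonzero polynomial in the coefficient variables vanishes on
`coeff(SmallCircuits ℂ n b)` and not at `coeff g` — a `Set.univ`-natural proof against
`SmallCircuits ℂ n b` with non-root `g`. (Converse of `Border.lt_approxComplexity` up to the
truncation exponents.) [cite: BurgisserEtAl2011, Def. 9.3.1] [cite: ForbesShpilkaVolk2018, Def. 1] -/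
theorem exists_univ_of_lt_approxComplexity {n b : ℕ} {g : MvPolynomial (Fin n) ℂ}
    (hdeg : g.totalDegree ≤ n) (hlt : n ^ b < approxComplexity g) :
    ∃ D : MvPolynomial (degLEMonomials n) ℂ,
      IsNaturalProof (degLEMonomials n) (SmallCircuits ℂ n b) Set.univ D ∧
      eval (coeffVector (degLEMonomials n) g) D ≠ 0 := by
  classical
  have hnot : coeffVector (degLEMonomials n) g ∉
      zariskiClosure (coeffVector (degLEMonomials n) '' SmallCircuits ℂ n b) := by
    intro hmem
    have hfull := coeffVec_mem_zariskiClosure_of_coeffVector_mem (R := n ^ b) hdeg hmem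
    have hle : approxComplexity g ≤ n ^ b := Nat.sInf_le hfull
    exact absurd hle (not_le.mpr hlt)
  rw [mem_zariskiClosure_iff] at hnot
  push Not at hnot
  obtain ⟨D, hvan, hne⟩ := hnot
  refine ⟨D, ⟨Set.mem_univ _, ?_, fun f hf => hvan _ ⟨f, hf, rfl⟩⟩, hne⟩
  rintro rfl
  exact hne (map_zero _)

/-- A function that is not p-bounded exceeds every power `n^b` beyond every threshold `n₀`
(a bound `n^b` for `n ≥ n₀` plus the finitely many earlier values would be a polynomial bound).
[cite: Burgisser2000, Def. 2.1(1)] -/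
theorem exists_ge_pow_lt_of_not_isPBounded {t : ℕ → ℕ} (ht : ¬ IsPBounded t) (b n₀ : ℕ) :
    ∃ n : ℕ, n₀ ≤ n ∧ n ^ b < t n := by
  classical
  by_contra hcon
  push Not at hcon
  apply ht
  rw [IsPBounded.iff_exists_le_mul_succ_pow]
  refine ⟨(∑ m ∈ Finset.range n₀, t m) + 1, b, fun n => ?_⟩
  have h2 : 1 ≤ (n + 1) ^ b := Nat.one_le_pow _ _ (Nat.succ_pos n)
  by_cases hn : n₀ ≤ n
  · calc t n ≤ n ^ b := hcon n hn
      _ ≤ (n + 1) ^ b := Nat.pow_le_pow_left (Nat.le_succ n) b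
      _ = 1 * (n + 1) ^ b := (one_mul _).symm
      _ ≤ ((∑ m ∈ Finset.range n₀, t m) + 1) * (n + 1) ^ b := Nat.mul_le_mul_right _ (by omega)
  · have hmem : n ∈ Finset.range n₀ := Finset.mem_range.mpr (by omega)
    have h1 : t n ≤ ∑ m ∈ Finset.range n₀, t m :=
      Finset.single_le_sum (fun m _ => Nat.zero_le (t m)) hmem
    calc t n ≤ (∑ m ∈ Finset.range n₀, t m) + 1 := by omega
      _ = ((∑ m ∈ Finset.range n₀, t m) + 1) * 1 := (mul_one _).symm
      _ ≤ ((∑ m ∈ Finset.range n₀, t m) + 1) * (n + 1) ^ b := Nat.mul_le_mul_left _ h2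

/-- **Item 18972 without constructivity ⟺ a pointwise-`VNP_{b₁}`-succinct family outside
`\overline{VP}`.** For a fixed definability exponent `b₁`: "for every `b`, infinitely often, SOME
nonzero equation of `coeff(SmallCircuits ℂ n b)` (no size or degree bound: `𝒟 = Set.univ`) has a
non-root in `SmallDefinable ℂ n b₁`" holds iff some family `h` with `h n ∈ SmallDefinable ℂ n b₁`
for all `n` has approximate complexity `\underline{L}(h_n)` NOT p-bounded (`¬ IsVPBarFamily h`,
BLMW 2011 §9.3). So the item's uniform quantifier `∃ b₁ ∀ b` WITHOUT its constructivity clause is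
the border separation "`VNP`-succinct slices ⊄ `\overline{VP}`"; the item proper
(`naturalProofsSeparateVNP_iff_exists_family`: a level-ONE natural proof at such a family) adds
constructivity `N^{O(1)}` on top. [cite: BurgisserEtAl2011, Def. 9.3.1 and §9.3] [cite: ForbesShpilkaVolk2018, Def. 1, §1.1] -/
theorem univ_separate_iff_exists_family {b₁ : ℕ} :
    (∀ b n₀ : ℕ, ∃ n : ℕ, n₀ ≤ n ∧ ∃ D : MvPolynomial (degLEMonomials n) ℂ,
      IsNaturalProof (degLEMonomials n) (SmallCircuits ℂ n b) Set.univ D ∧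
      ∃ g ∈ SmallDefinable ℂ n b₁, eval (coeffVector (degLEMonomials n) g) D ≠ 0) ↔
    ∃ h : ∀ n, MvPolynomial (Fin n) ℂ, (∀ n, h n ∈ SmallDefinable ℂ n b₁) ∧ ¬ IsVPBarFamily h := by
  constructor
  · intro hsep
    obtain ⟨h, hh, hnat⟩ := exists_family_of_separate (𝒟 := fun _ => Set.univ) hsep
    exact ⟨h, hh, not_isVPBarFamily_of_family hnat⟩
  · rintro ⟨h, hh, hbar⟩ b n₀
    obtain ⟨n, hn, hlt⟩ := exists_ge_pow_lt_of_not_isPBounded hbar b n₀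
    obtain ⟨D, hD, hne⟩ := exists_univ_of_lt_approxComplexity (hh n).1 hlt
    exact ⟨n, hn, D, hD, h n, hh n, hne⟩

/-- Hence the non-constructive uniform statement already yields `VNP ⊄ \overline{VP}` (a
p-definable family — `KRSTResidualBand.isVNPFamily_of_mem_smallDefinable` — with `\underline{L}` not
p-bounded); composed with `univ_separate_of_naturalProofsSeparateVNP` this is a second derivation of
`Border.exists_isVNPFamily_not_isVPBarFamily` (`S ⇒ VNP ⊄ \overline{VP}`). [cite: BurgisserEtAl2011, §9.3] -/
theorem exists_isVNPFamily_not_isVPBarFamily_of_univ_separate {b₁ : ℕ}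
    (hsep : ∀ b n₀ : ℕ, ∃ n : ℕ, n₀ ≤ n ∧ ∃ D : MvPolynomial (degLEMonomials n) ℂ,
      IsNaturalProof (degLEMonomials n) (SmallCircuits ℂ n b) Set.univ D ∧
      ∃ g ∈ SmallDefinable ℂ n b₁, eval (coeffVector (degLEMonomials n) g) D ≠ 0) :
    ∃ h : ∀ n, MvPolynomial (Fin n) ℂ, IsVNPFamily h ∧ ¬ IsVPBarFamily h := by
  obtain ⟨h, hh, hbar⟩ := univ_separate_iff_exists_family.mp hsep
  exact ⟨h, KRSTResidualBand.isVNPFamily_of_mem_smallDefinable hh, hbar⟩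

/-- The item implies its non-constructive uniform form (drop `D ∈ Distinguishers ℂ n 1`).
[cite: ForbesShpilkaVolk2018, Def. 1] -/
theorem univ_separate_of_naturalProofsSeparateVNP (hS : BarrierLever.NaturalProofsSeparateVNP) :
    ∃ b₁ : ℕ, ∀ b n₀ : ℕ, ∃ n : ℕ, n₀ ≤ n ∧ ∃ D : MvPolynomial (degLEMonomials n) ℂ,
      IsNaturalProof (degLEMonomials n) (SmallCircuits ℂ n b) Set.univ D ∧
      ∃ g ∈ SmallDefinable ℂ n b₁, eval (coeffVector (degLEMonomials n) g) D ≠ 0 := by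
  obtain ⟨b₁, h⟩ := hS
  refine ⟨b₁, fun b n₀ => ?_⟩
  obtain ⟨n, hn, D, ⟨-, hD, hvan⟩, g, hg, hne⟩ := h b n₀
  exact ⟨n, hn, D, ⟨Set.mem_univ _, hD, hvan⟩, g, hg, hne⟩

end Nonconstructive

end Summit.ValiantsHypothesis.ValiantsHypothesis.Theorems.BarrierLever.NaturalProofsSeparateVNP

end
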